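import Summits.QuantumFields.YangMills.Theorems.AllWindowsColdBoxBulkMidSandwichLinearVariance

/-!
# LOCALISED Brascamp–Lieb for linear statistics under the sandwich ("BL localises to the core")
# (crux idea `logconcave-core-extension` on ⟨stmt-QuantumFields-24006⟩, piece P5′ at the LOCAL constant)

`bl_linear_localised` (whitened frame, `A ∈ C²`, global sandwich with `δ < 1`, and on a measurable set `K'` the
better LOCAL Hessian floor `(1−r')|v|² ≤ D²A(x)(v,v)`, `r' < 1`):
`(∫(x·b)²e^{−A})Z − (∫(x·b)e^{−A})² ≤ |b|²·((1−r')⁻¹·∫_{K'}e^{−A} + (1−δ)⁻¹·(Z − ∫_{K'}e^{−A}))·Z`,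
i.e. `Var_A(x·b) ≤ |b|²[(1−r')⁻¹ μ_A(K') + (1−δ)⁻¹ μ_A(K'ᶜ)]` — the variance of a LINEAR statistic sees the sandwich
constant of the core up to the (tiny) mass of its complement.  Source: the tree's PROVED pointwise Brascamp–Lieb
`Literature.Probability.Distributions.bl_wholeSpace_raw` (Brascamp–Lieb 1976 Thm 4.1: `Var h ≤ E⟨∇h,(A_xx)⁻¹∇h⟩`) with
`∇(x·b) = b` and the pointwise bounds `bᵀ(A_xx)⁻¹b ≤ |b|²/(1−r')` on `K'`, `≤ |b|²/(1−δ)` elsewhere (`inv_quadForm_le`).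
This is the precision the card's S7 lin×lin block needs (`r_K`, not `r_U`).

HONEST SCOPE.  Free-hands work of the LEAD seat of ⟨stmt-QuantumFields-24006⟩ (FCL lineage) on an ingredient of an
UN-TRIAGED crux idea card; classical log-concave probability.  No stub of LINE-18, no crux, rung or summit is proved; the
Yang–Mills mass gap is NOT proved by any of this.
-/

noncomputable section

namespace Summit.QuantumFields.YangMills.Theorems.SandwichVariancePinching

open MeasureTheory Real Filter Topology Set
open Literature.Probability.Distributions (coordGradient coordHessian bl_wholeSpace_raw continuous_blQuad)

variable {n : ℕ}

/-- **LOCALISED BRASCAMP–LIEB FOR A LINEAR STATISTIC** (whitened frame, `A ∈ C²`): with the global sandwich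
(`δ < 1`) and a local Hessian floor `(1−r')|v|² ≤ D²A(x)(v,v)` on a measurable `K'` (`r' < 1`),
`(∫(x·b)²e^{−A})Z − (∫(x·b)e^{−A})² ≤ |b|²((1−r')⁻¹∫_{K'}e^{−A} + (1−δ)⁻¹(Z − ∫_{K'}e^{−A}))Z`.
[cite: BrascampLieb1976, Thm 4.1 — via the tree's `bl_wholeSpace_raw`] -/
theorem bl_linear_localised {A : (Fin n → ℝ) → ℝ} (hA : ContDiff ℝ 2 A) {δ : ℝ} (hδ1 : δ < 1)
    (hsw : ∀ x h : Fin n → ℝ, (1 - δ) * (h ⬝ᵥ h) ≤ A (x + h) + A (x - h) - 2 * A x ∧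
      A (x + h) + A (x - h) - 2 * A x ≤ (1 + δ) * (h ⬝ᵥ h)) (b : Fin n → ℝ)
    {K' : Set (Fin n → ℝ)} (hK' : MeasurableSet K') {r' : ℝ} (hr' : r' < 1)
    (hloc : ∀ x ∈ K', ∀ v : Fin n → ℝ, (1 - r') * (v ⬝ᵥ v) ≤ fderiv ℝ (fderiv ℝ A) x v v) :
    (∫ x, (x ⬝ᵥ b) ^ 2 * exp (-A x)) * (∫ x, exp (-A x)) - (∫ x, (x ⬝ᵥ b) * exp (-A x)) ^ 2 ≤
      (b ⬝ᵥ b) * ((1 - r')⁻¹ * (∫ x in K', exp (-A x)) +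
        (1 - δ)⁻¹ * ((∫ x, exp (-A x)) - ∫ x in K', exp (-A x))) * ∫ x, exp (-A x) := by
  have hAc : Continuous A := hA.continuous
  have hpd := posDef_coordHessian hA hδ1 hsw
  -- the linear observable
  have hh : ContDiff ℝ 1 (fun x : Fin n → ℝ => x ⬝ᵥ b) := by
    have e : (fun x : Fin n → ℝ => x ⬝ᵥ b) = fun x => ∑ i, x i * b i := by funext x; rfl
    rw [e]
    exact ContDiff.sum fun i _ => (contDiff_apply ℝ ℝ i).mul contDiff_const
  have hfd : ∀ x : Fin n → ℝ, ∀ v, fderiv ℝ (fun y : Fin n → ℝ => y ⬝ᵥ b) x v = v ⬝ᵥ b := by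
    intro x v
    obtain ⟨Lx, hLx, hLxv⟩ :=
      Literature.MathematicalPhysics.QuantumFieldTheory.Balaban1983to89.B14.Eq328GaussianIBP.hasFDerivAt_dotProduct_const
        b x
    rw [hLx.fderiv, hLxv]
  have hgrad : ∀ x, coordGradient (fun y : Fin n → ℝ => y ⬝ᵥ b) x = b := by
    intro x; funext i
    simp only [coordGradient, hfd]
    simp [dotProduct, Pi.single_apply]
  -- integrability
  have hZ : Integrable fun x => exp (-A x) := by
    have := integrable_tilt hAc hδ1 hsw b 0 continuous_const (w := fun _ => (1:ℝ)) (D := 1) (k := 0)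
      (by norm_num) (fun x => by simp)
    simpa using this
  have hI1 : Integrable fun x => (x ⬝ᵥ b) * exp (-A x) := by
    have := integrable_tilt hAc hδ1 hsw b 0 (continuous_id.dotProduct continuous_const)
      (w := fun x => x ⬝ᵥ b) (k := 1) (by norm_num) (abs_dotProduct_const_le b)
    simpa using this
  have hI2 : Integrable fun x => (x ⬝ᵥ b) ^ 2 * exp (-A x) := by
    have hb2 : ∀ x : Fin n → ℝ, |(x ⬝ᵥ b) ^ 2| ≤ (∑ i, |b i|) * (∑ i, |b i|) * (1 + ‖x‖) ^ (1 + 1) := by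
      intro x
      have := abs_mul_le_growth (abs_dotProduct_const_le b) (abs_dotProduct_const_le b) x
      simpa [sq] using this
    have := integrable_tilt hAc hδ1 hsw b 0 ((continuous_id.dotProduct continuous_const).pow 2)
      (w := fun x => (x ⬝ᵥ b) ^ 2) (k := 2) (by norm_num) hb2
    simpa using this
  -- the dominating weight `g`
  set c₁ : ℝ := (1 - r')⁻¹ with hc₁
  set c₀ : ℝ := (1 - δ)⁻¹ with hc₀
  set g : (Fin n → ℝ) → ℝ := fun x =>
    (b ⬝ᵥ b) * c₀ * exp (-A x) + (b ⬝ᵥ b) * (c₁ - c₀) * K'.indicator (fun x => exp (-A x)) x with hg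
  have hgi : Integrable g := (hZ.const_mul _).add ((hZ.indicator hK').const_mul _)
  -- pointwise: the Brascamp–Lieb integrand is below `g`
  have hbb : 0 ≤ b ⬝ᵥ b := by simpa using dotProduct_self_star_nonneg b
  have hQle : ∀ x, coordGradient (fun y : Fin n → ℝ => y ⬝ᵥ b) x ⬝ᵥ
      (coordHessian A x)⁻¹.mulVec (coordGradient (fun y : Fin n → ℝ => y ⬝ᵥ b) x) * exp (-A x) ≤ g x := by
    intro x
    have hd : DifferentiableAt ℝ (fderiv ℝ A) x :=
      ((hA.fderiv_right (m := 1) (by norm_num)).differentiable (by norm_num)) x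
    rw [hgrad x]
    have he := (exp_pos (-A x)).le
    by_cases hx : x ∈ K'
    · have hq : b ⬝ᵥ (coordHessian A x)⁻¹.mulVec b ≤ c₁ * (b ⬝ᵥ b) := by
        refine inv_quadForm_le (hpd x) (by linarith) (fun w => ?_) b
        rw [Literature.Probability.Distributions.dotProduct_coordHessian_mulVec hd]
        exact hloc x hx w
      simp only [hg, indicator_of_mem hx]
      nlinarith
    · have hq : b ⬝ᵥ (coordHessian A x)⁻¹.mulVec b ≤ c₀ * (b ⬝ᵥ b) := by
        have := blQuad_le_of_sandwich hA hδ1 hsw (fun y : Fin n → ℝ => y ⬝ᵥ b) x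
        rwa [hgrad x] at this
      simp only [hg, indicator_of_notMem hx, mul_zero, add_zero]
      nlinarith
  -- integrability of the BL integrand (dominated by `g`)
  have hQc := continuous_blQuad hA hpd hh
  have hQ0 := fun x => Literature.Probability.Distributions.blQuad_nonneg (h := fun y : Fin n → ℝ => y ⬝ᵥ b) hpd x
  have hIQ : Integrable fun x => coordGradient (fun y : Fin n → ℝ => y ⬝ᵥ b) x ⬝ᵥ
      (coordHessian A x)⁻¹.mulVec (coordGradient (fun y : Fin n → ℝ => y ⬝ᵥ b) x) * exp (-A x) := by
    refine hgi.mono' ((hQc.mul (continuous_exp.comp hAc.neg)).aestronglyMeasurable) (ae_of_all _ fun x => ?_)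
    rw [Real.norm_eq_abs, abs_of_nonneg (mul_nonneg (hQ0 x) (exp_pos _).le)]
    exact hQle x
  -- Brascamp–Lieb and the integral of `g`
  have hraw := bl_wholeSpace_raw hA hpd hh hZ hI1 (by simpa [sq] using hI2) hIQ
  have hmono : ∫ x, coordGradient (fun y : Fin n → ℝ => y ⬝ᵥ b) x ⬝ᵥ
      (coordHessian A x)⁻¹.mulVec (coordGradient (fun y : Fin n → ℝ => y ⬝ᵥ b) x) * exp (-A x) ≤ ∫ x, g x :=
    integral_mono hIQ hgi hQle
  have hgint : ∫ x, g x = (b ⬝ᵥ b) * (c₁ * (∫ x in K', exp (-A x)) +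
      c₀ * ((∫ x, exp (-A x)) - ∫ x in K', exp (-A x))) := by
    simp only [hg]
    rw [integral_add (hZ.const_mul _) ((hZ.indicator hK').const_mul _), integral_const_mul, integral_const_mul,
      integral_indicator hK']
    ring
  have hZ0 : 0 ≤ ∫ x, exp (-A x) := integral_nonneg fun x => (exp_pos _).le
  have hsq : (∫ x, (x ⬝ᵥ b) ^ 2 * exp (-A x)) = ∫ x, (fun y : Fin n → ℝ => y ⬝ᵥ b) x ^ 2 * exp (-A x) := rfl
  rw [hsq]
  calc (∫ x, (fun y : Fin n → ℝ => y ⬝ᵥ b) x ^ 2 * exp (-A x)) * (∫ x, exp (-A x)) -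
        (∫ x, (x ⬝ᵥ b) * exp (-A x)) ^ 2
      ≤ (∫ x, coordGradient (fun y : Fin n → ℝ => y ⬝ᵥ b) x ⬝ᵥ
          (coordHessian A x)⁻¹.mulVec (coordGradient (fun y : Fin n → ℝ => y ⬝ᵥ b) x) * exp (-A x)) *
          ∫ x, exp (-A x) := hraw
    _ ≤ (∫ x, g x) * ∫ x, exp (-A x) := mul_le_mul_of_nonneg_right hmono hZ0
    _ = (b ⬝ᵥ b) * ((1 - r')⁻¹ * (∫ x in K', exp (-A x)) +
        (1 - δ)⁻¹ * ((∫ x, exp (-A x)) - ∫ x in K', exp (-A x))) * ∫ x, exp (-A x) := by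
        rw [hgint]

end Summit.QuantumFields.YangMills.Theorems.SandwichVariancePinching

end
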